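import Mathlib
import Literature.Topology.FourManifolds.Trisections
import Literature.Topology.FourManifolds.PropertyRTraceClosing
import Literature.Topology.FourManifolds.MorseTwoCriticalPoints
import Literature.Topology.FourManifolds.AkbulutKirbyCerfReduction
import Literature.Topology.FourManifolds.SPC4HandlesImpliesCerf
import Literature.Topology.FourManifolds.HeegaardSplittingMorse
import Literature.Topology.FourManifolds.MorseProofs
import HarnessLib

/-!
# TrisectionHandleDecomposition

Topic `Literature/Topology/FourManifolds`. Named literature fact(s) relocated by the gate from `Summits/SmoothPoincare4/SmoothPoincare4/Theorems/WeakReductionDescentLowGenusBaseLeaves.lean`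
(accept-time relocation of `[cite]`d propositions written inline in a Summits proposal; human ruling 2026-08-15).
Sources: GayKirby2016, MeierSchirmerZupan2016, MilnorHCobordism1965.

* `Literature.Topology.FourManifolds.gkTrisection_exists_isMorse_isSelfIndexing`

## Proof status (provefact seats, 2026-08-17): not discharged; bookkeeping half proved

Sibling proof file `TrisectionHandleDecompositionProofs.lean` (everything there proved, no new
facts): the fact is reduced to its geometric half — *a `(g; k 0, k 1, k 2)`-trisected closed
connected oriented smooth `4`-manifold carries a Morse function with exactly one critical point
of index `0`, `k 0` of index `1`, `k 2` of index `3` and one of index `4`*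
(`gkTrisection_exists_isMorse_isSelfIndexing_of_exists_isMorse_ncard`; the index-`2` count
`g - k 1` and self-indexing then follow from `χ(X) = 2 + g - Σ kᵢ`, the Morse count and Milnor's
Thm. 4.8, `IsGKTrisection.exists_isSelfIndexing_of_isMorse_ncard`), and API corollaries for
relabelled sectors (`…comp_perm`, `…swap`) are provided.  The geometric half is not proved: over
`IsGKTrisection` (no standardness clause, unlike Gay–Kirby's Def. 1 (2)) "the middle sector is
`[0, ε] × H₁₂` with the `2`-handles" is the standardness of the genus-`g` Heegaard splitting of
`∂X₂ ≅ #^{k₁}(S¹ × S²)`, which the printed sources take from Waldhausen's theorem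
(Meier–Schirmer–Zupan 2016, p. 8, before Lemma 4.6: the complete collection of primitive discs
exists by their Thm. 2.7 [Waldhausen]); prerequisites, both unproved named facts of the tree:
`Literature.Topology.FourManifolds.waldhausen_heegaardSplitting_sumS1S2_unique`
(`HeegaardSplittingsS1S2Sums.lean`) and Laudenbach–Poénaru
`Literature.Topology.FourManifolds.exists_diffeomorph_comp_incl_eq` (`SPC4Handles.lean`).  See the
sibling's section "Proof status of the geometric half" for the Waldhausen-free counts
`(1, k₀ + k₁, g, k₂, 1)` / `(1, k₀, g, k₁ + k₂, 1)` and why the surplus pairs do not cancel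
without that input.  The statement is true as printed (not mis-stated).

## Review (split-review seat, 2026-08-17, gen. 3): statement faithful and published; XL (Waldhausen)

Outcome of the review protocol ((a) prove inline / (b) restate or merge / (c) mis-stated or
open problem), decided with both sources open (held texts `paper:arxiv-1205.1565`,
`paper:arxiv-1507.06561`):

* **The statement is a faithful transcription of a published, proved result — neither (b) nor
  (c) applies.**  Meier–Schirmer–Zupan's Definition 1.1 ("`X = X₁ ∪ X₂ ∪ X₃`; `Xᵢ` is a
  four-dimensional `1`-handlebody of genus `kᵢ`; `Xᵢ ∩ Xⱼ` is a three-dimensional handlebody of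
  genus `g` for `i ≠ j`; `Σ = X₁ ∩ X₂ ∩ X₃` is a closed orientable surface of genus `g`"; "slightly
  more general than the original one") has no standardness clause and is, for closed connected
  oriented `X`, clause for clause the tree's `IsGKTrisection` (sectors straightened along `Σ`).
  Over it, §4 prints the vendored conclusion: a `(g; k₁, k₂, k₃)`-trisection yields a
  `(g; k₁, g − k₂, k₃)` Heegaard–Kirby diagram (paragraph before Lemma 4.6, and Lemma 4.6), whose
  framed link "determines a handle decomposition of a closed four-manifold `X` which consists of
  a single `0`-handle, `n` `1`-handles, `c` `2`-handles, `m` `3`-handles, and a single `4`-handle"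
  (Def. 4.1).  Gay–Kirby's Lemma 13 is the same statement over their Def. 1, whose clause (2)
  (`φᵢ(Xᵢ ∩ X_{i±1}) = Y^∓_{k,g}`) *is* the standardness; their proof opens with it ("each sector
  … is `♮ᵏ(S¹ × B³)` with a genus `g` splitting of its boundary.  Thus it has a standard Morse
  `2`-function onto a wedge").  The dependents
  (`Summits/…/WeakReductionDescentLowGenusBaseLeaves.lean`, slices `(g; g, 0, 0) ↦ (0, g, 0)` and
  `(2; 1, 1, 0) ↦ (0, 1, 1)`) consume exactly this content (after relabelling `k 0 = 0`, all the
  weight is on the middle sector), so the leaf is not mis-cut for its users either.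
* **Why (a) is out of reach of a seat.**  MSZ take the decisive input from Waldhausen: "Theorem 2.7
  implies that for every Heegaard splitting `(Σ, H, H′)` for `#ᵏ(S¹ × S²)`, there is a complete
  collection of primitive disks for `H`" (§4, after Def. 4.5), and identify the sectors with the
  models by Laudenbach–Poénaru (§3: "there is a unique way to cap off each of these boundary
  components").  In the tree these are the unproved named facts
  `waldhausen_heegaardSplitting_sumS1S2_unique` and `exists_diffeomorph_comp_incl_eq`; Waldhausen's
  theorem in turn rests on Haken's lemma (MSZ Thm. 2.9) and sweep-out / thin-position arguments,
  and no `3`-manifold topology of that kind exists in Mathlib or `Literature/` (searched `Haken`,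
  `reducing sphere`, `IsReducibleSplitting`: only the `4`-dimensional
  `ReducibleTrisectionSplitting.lean`).  Two provefact seats and this review concur: XL.
* **No trisection-specific shortcut.**  Every genus-`g` Heegaard splitting `(H, H′)` of
  `Y ≅ #ᵏ(S¹ × S²)` occurs, up to diffeomorphism, as the splitting `(S 0 ∩ S 1, S 1 ∩ S 2)` of
  the boundary of the middle sector of a `(g; k, k, g)`-trisection in the sense of
  `IsGKTrisection`: in the double `V ∪_Y V̄` of a `1`-handlebody `V` with `∂V ≅ Y` let `S 2` be a
  thickening of `H′` pinched along `∂H′` (a genus-`g` `1`-handlebody after straightening, with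
  faces two copies of `H′`) and `S 0`, `S 1` the closures of the two remaining pieces (`≅ V`, `V̄`,
  meeting along `H`).  So an argument that reads the counts off the handle structure of the
  middle sector relative to `S 0 ∩ S 1` must treat an *arbitrary* Heegaard splitting of
  `#ᵏ(S¹ × S²)`; the rest of the trisection imposes no constraint on it.
* **What the handle count itself uses** is `k₁`-fold reducibility of that splitting (together
  with Laudenbach–Poénaru, as before, to realise the reducing spheres as belt spheres of the
  middle sector's `1`-handles): if `(H₀₁, H₁₂)` is the connected sum of the genus-`k₁` splitting of
  `#^{k₁}(S¹ × S²)` with *some* genus-`(g − k₁)` splitting of `S³` (Haken's lemma iterated, with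
  Kneser–Milnor), then in `S 0 ∪_{H₀₁} S 1 ≅ (Z_{k₀} ♮ Z_{k₁}) ∪ g` `2`-handles the `k₁`
  `2`-handles running along the cores of the `#^{k₁}`-summand of `H₀₁` cancel the `1`-handles
  of `S 1`, leaving `Z_{k₀} ∪ (g − k₁)` `2`-handles whatever the `S³`-summand is, and `S 2`, glued
  along its whole boundary, adds `k₂` `3`-handles and the `4`-handle: `(1, k 0, g − k 1, k 2, 1)`.
  For `k 1 = 0` (middle sector a `4`-ball) no `3`-manifold input is needed at all; for the
  dependents the inputs are the genus-`2` splittings of `#²(S¹ × S²)` (slice A, `g = 2`) and of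
  `S¹ × S²` (slice B), while slice A with `g = 1` could be relabelled `(0, 0, 1)` instead and
  closed by Property R exactly like slice B — recorded for the planner; nothing is re-filed here.
* **Verdict:** blocked on `Literature.Topology.FourManifolds.waldhausen_heegaardSplitting_sumS1S2_unique`
  (event-parked); nothing new is named (D-0026), the statement below is unchanged.
-/

namespace Literature.Topology.FourManifolds

open scoped Manifold ContDiff ContinuousMap
open Set Literature.Topology.FourManifolds

/-- **Gay–Kirby 2016, Lemma 13: a trisection induces a handle decomposition** (unbalanced
bookkeeping as in Meier–Schirmer–Zupan 2016, §4: a `(g; k₁, k₂, k₃)`-trisection yields a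
`(g; k₁, g − k₂, k₃)` Heegaard–Kirby diagram, Def. 4.1 and Lemma 4.6).  Printed statement
(GK, arXiv p. 13): *"If `X = X₁ ∪ X₂ ∪ X₃` is a trisection of a 4-manifold `X`, then there is a
handle decomposition of `X` as in Theorem 4* [one `0`-handle, `k` `1`-handles, `g − k` `2`-handles,
`k` `3`-handles and one `4`-handle] *satisfying the following properties: `X₁` is the union of the
`0`- and `1`-handles; … `X₂` is the union of `[0, ε] × H₁₂` with the `2`-handles"* (so `X₃` is the
union of the `3`- and `4`-handles); MSZ Def. 4.1: the framed link of a `(g; n, c, m)` Heegaard–Kirby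
diagram *"determines a handle decomposition of a closed four-manifold `X` which consists of a
single `0`-handle, `n` `1`-handles, `c` `2`-handles, `m` `3`-handles, and a single `4`-handle"*,
with `(n, c, m) = (k₁, g − k₂, k₃)` for the diagram `ℒ(𝒟)` of a `(g; k₁, k₂, k₃)`-trisection
(§4, before Lemma 4.6).  Tree rendering, in the Morse-theoretic idiom of `SPC4Handles.lean` (b)
(a handle decomposition of a closed manifold with the handles attached in order of increasing
index = a self-indexing Morse function, Milnor 1965 Thm. 4.8; counts by `criticalSetOfIndex`):
for a closed connected oriented smooth 4-manifold `X` with a `(g; k 0, k 1, k 2)`-trisection in the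
tree's corrected sense `IsGKTrisection X g k S` (sectors with corners along the central surface,
`Trisections.lean`, where its agreement with Gay–Kirby's Def. 1 is argued), there is a self-indexing
Morse function on `X` with exactly one critical point of index `0`, `k 0` of index `1`, `g - k 1` of
index `2`, `k 2` of index `3` and one of index `4`.  Only the handle counts are vendored (not the
position of the sectors relative to the handles); by the symmetry `IsGKTrisection.comp_perm` the
statement for this labelling of the sectors gives it for all.  Users take
`(h : gkTrisection_exists_isMorse_isSelfIndexing)`.
[cite: GayKirby2016, Lemma 13 (with Thm. 4)] [cite: MeierSchirmerZupan2016, §4, Def. 4.1 and Lemma 4.6]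
[cite: MilnorHCobordism1965, Thm. 4.8] [file Topology/FourManifolds/TrisectionHandleDecomposition] -/
def gkTrisection_exists_isMorse_isSelfIndexing : Prop :=
  ∀ (X : Type) [TopologicalSpace X] [T2Space X] [SecondCountableTopology X]
    [ChartedSpace (EuclideanSpace ℝ (Fin 4)) X]
    [IsManifold (modelWithCornersSelf ℝ (EuclideanSpace ℝ (Fin 4))) ((⊤ : ℕ∞) : WithTop ℕ∞) X]
    [CompactSpace X] [ConnectedSpace X]
    (_ : Literature.Topology.FourManifolds.SmoothOrientation
      (modelWithCornersSelf ℝ (EuclideanSpace ℝ (Fin 4))) X)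
    (g : ℕ) (k : Fin 3 → ℕ) (S : Fin 3 → Set X),
    Literature.Topology.FourManifolds.IsGKTrisection X g k S →
    ∃ f : X → ℝ,
      Literature.Topology.FourManifolds.IsMorse (modelWithCornersSelf ℝ (EuclideanSpace ℝ (Fin 4))) f ∧
      Literature.Topology.FourManifolds.IsSelfIndexing
        (modelWithCornersSelf ℝ (EuclideanSpace ℝ (Fin 4))) f ∧
      (Literature.Topology.FourManifolds.criticalSetOfIndex
        (modelWithCornersSelf ℝ (EuclideanSpace ℝ (Fin 4))) f 0).ncard = 1 ∧
      (Literature.Topology.FourManifolds.criticalSetOfIndex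
        (modelWithCornersSelf ℝ (EuclideanSpace ℝ (Fin 4))) f 1).ncard = k 0 ∧
      (Literature.Topology.FourManifolds.criticalSetOfIndex
        (modelWithCornersSelf ℝ (EuclideanSpace ℝ (Fin 4))) f 2).ncard = g - k 1 ∧
      (Literature.Topology.FourManifolds.criticalSetOfIndex
        (modelWithCornersSelf ℝ (EuclideanSpace ℝ (Fin 4))) f 3).ncard = k 2 ∧
      (Literature.Topology.FourManifolds.criticalSetOfIndex
        (modelWithCornersSelf ℝ (EuclideanSpace ℝ (Fin 4))) f 4).ncard = 1

end Literature.Topology.FourManifolds
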